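import Literature.AlgebraicGeometry.Motives.FaltingsECTateFiniteEndProofs
import Literature.AlgebraicGeometry.Motives.FaltingsECTateMainTheoremProofs
import Mathlib.LinearAlgebra.Matrix.ToLinearEquiv
import Mathlib.LinearAlgebra.Matrix.Trace
import Mathlib.LinearAlgebra.FiniteDimensional.Lemmas
import Mathlib.RingTheory.Localization.Integer
import Mathlib.Tactic.NoncommRing
import Mathlib.Tactic.Module
import HarnessLib

/-!
# Tate's theorem, `ℚ_ℓ`-form, for an elliptic curve with non-commutative `End_k(E)`

Sibling file of `Literature.AlgebraicGeometry.Motives.FaltingsEC` (D-0014), serving the named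
fact `Literature.AlgebraicGeometry.Motives.mem_span_range_tateEndRingHom_iff_of_finite` (Tate, Invent. Math. 2 (1966),
Main Theorem, `End` form). In the *central* case of that theorem (the arithmetic Frobenius acts
on `T_ℓ E` as a scalar, `E` supersingular with `π ∈ ℤ`) the content of the theorem is that
`ℚ_ℓ ⊗ End_k(E) → End(V_ℓ E)` is onto, i.e. that `End_k(E)` has rank `4` (Waterhouse, Ann. Sci.
ÉNS 2 (1969), Thm. 4.1 and Ch. 2: `E = End_k(A) ⊗ ℚ` "is the unique quaternion algebra ramified
only at `p` and `∞`"). This file isolates the **algebra step**: it suffices that `End_k(E)` be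
**non-commutative**.

* `Literature.AlgebraicGeometry.Motives.subring_comm_of_span_ne_top`: a subring `R ⊆ M₂(L)` (`L` a field, `2 ≠ 0`) all of
  whose non-zero elements are invertible and whose `L`-span is not `M₂(L)` is commutative
  (a non-commutative such `R` spans a `3`-dimensional subalgebra `L + Lr + Ls`, and
  `n = rs - sr ∈ R` is a non-zero `ad`-eigenvector, whence `tr n = tr n² = 0` and `det n = 0`).
* `Literature.AlgebraicGeometry.Motives.exists_pow_smul_mem_span_range_tateEndRingHom_of_mul_ne`: for an elliptic curve `E`
  over any field `K`, a prime `ℓ ≠ char K`, and two elements of `End_K(E)` which do not commute,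
  **every** `ℤ_ℓ`-linear endomorphism `g` of `T_ℓ E` has `ℓ ^ n • g ∈ ℤ_ℓ · End_K(E)` for some
  `n`: the image `R` of `End_K(E)` in `End(T_ℓ E) ≅ M₂(ℤ_ℓ) ⊆ M₂(ℚ_ℓ)` is a non-commutative
  subring whose non-zero elements — Tate modules maps of isogenies, injective (the tree's
  `tateModule_map_injective`) — are invertible in `M₂(ℚ_ℓ)`, so `ℚ_ℓ R = M₂(ℚ_ℓ)`, and
  denominators are cleared in `ℤ_ℓ`.

With the tree's Lemma 1 (`ℤ_ℓ · End_K(E)` is saturated in `End(T_ℓ E)`,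
`FaltingsECEndomorphismsProofs`) this gives the `End` form of Tate's theorem for every elliptic
curve over a finite field whose endomorphism ring over `k` is non-commutative
(`Literature.AlgebraicGeometry.Motives.mem_span_range_tateEndRingHom_of_mul_ne`).

## References

* [Tate1966Endomorphisms] J. Tate, *Endomorphisms of abelian varieties over finite fields*,
  Invent. Math. 2 (1966), 134–144, Main Theorem, §1 Lemma 1, §2 (Proposition 2, Lemma 4).
* [Waterhouse1969] W. C. Waterhouse, *Abelian varieties over finite fields*, Ann. Sci. ÉNS (4) 2
  (1969), Ch. 2 (pp. 526–528) and Thm. 4.1.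
* [SilvermanAEC2009] J. H. Silverman, *The Arithmetic of Elliptic Curves*, 2nd ed., GTM 106,
  III.§4, III.7.1, III.7.4, III.7.7(a), V.§3.
-/

noncomputable section

open scoped Classical

universe u

/-! ## `2 × 2` matrices: subrings of `M₂(L)` without singular elements -/

namespace Literature.AlgebraicGeometry.Motives

open Matrix Module

/-- The trace of `n²` for a `2 × 2` matrix: `tr(n²) = tr(n)² - 2 det(n)`. [folklore] -/
theorem trace_mul_self_fin_two {R : Type*} [CommRing R] (n : Matrix (Fin 2) (Fin 2) R) :
    (n * n).trace = n.trace ^ 2 - 2 * n.det := by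
  rw [Matrix.trace_fin_two, Matrix.trace_fin_two, Matrix.det_fin_two]
  simp [Matrix.mul_apply, Fin.sum_univ_two]
  ring

/-- If `[r, n] = c • n` with `c ≠ 0` (over a field), then `tr(n²) = 0`: `n² = c⁻¹ n [r, n]` and
`tr(n r n) = tr(n n r)`. [folklore] -/
theorem trace_mul_self_eq_zero_of_lie_eq_smul {L : Type*} [Field L] {m : Type*} [Fintype m]
    [DecidableEq m] {r n : Matrix m m L} {c : L} (hc : c ≠ 0) (h : r * n - n * r = c • n) :
    (n * n).trace = 0 := by
  have h1 : n * n = c⁻¹ • (n * (r * n - n * r)) := by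
    rw [h, Matrix.mul_smul, smul_smul, inv_mul_cancel₀ hc, one_smul]
  rw [h1, Matrix.trace_smul, Matrix.mul_sub, Matrix.trace_sub, Matrix.trace_mul_comm n (r * n),
    Matrix.mul_assoc, ← Matrix.mul_assoc n n r, Matrix.trace_mul_comm (n * n) r, ← Matrix.mul_assoc,
    sub_self, smul_zero]

/-- **A subring of `M₂(L)` without non-zero singular elements whose `L`-span is a proper subspace
is commutative.** Let `L` be a field with `2 ≠ 0` and `R ⊆ M₂(L)` a subring all of whose non-zero
elements are invertible. If the `L`-span `𝒜` of `R` is not all of `M₂(L)`, then `R` is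
commutative. (If `r, s ∈ R` do not commute then `𝒜 = L + Lr + Ls` has dimension `3`,
`n = rs - sr ∈ R` is a non-zero `ad`-eigenvector of `r` and `s`, whence `tr n = tr n² = 0`,
`det n = 0`.) The contrapositive is the algebra step of Tate's proof of his isogeny theorem for a
supersingular elliptic curve with all endomorphisms defined over the ground field (Tate, §2,
Proposition 2 with Lemma 4, where the semisimple algebra `F ⊗ ℚ_ℓ = End_k(E) ⊗ ℚ_ℓ` is shown to
be its own bicommutant). Elementary. [folklore] -/
theorem subring_comm_of_span_ne_top {L : Type*} [Field L] (h2 : (2 : L) ≠ 0)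
    (R : Subring (Matrix (Fin 2) (Fin 2) L)) (hR : ∀ r ∈ R, r ≠ 0 → IsUnit r)
    (hne : Submodule.span L (R : Set (Matrix (Fin 2) (Fin 2) L)) ≠ ⊤) :
    ∀ r ∈ R, ∀ s ∈ R, r * s = s * r := by
  by_contra! hrs
  obtain ⟨r, hr, s, hs, hrs⟩ := hrs
  set A : Submodule L (Matrix (Fin 2) (Fin 2) L) := Submodule.span L (R : Set _) with hA
  have hlt : finrank L A < 4 := by
    have := Submodule.finrank_lt hne
    simpa [Module.finrank_matrix] using this
  -- a non-trivial relation among `1, r, s` would make `r` and `s` commute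
  have hrel : ∀ g₀ g₁ g₂ : L, g₀ • (1 : Matrix (Fin 2) (Fin 2) L) + g₁ • r + g₂ • s = 0 →
      g₀ = 0 ∧ g₁ = 0 ∧ g₂ = 0 := by
    intro g₀ g₁ g₂ hg
    by_cases h₂ : g₂ = 0
    · by_cases h₁ : g₁ = 0
      · simp only [h₁, h₂, zero_smul, add_zero] at hg
        have h1ne : (1 : Matrix (Fin 2) (Fin 2) L) ≠ 0 := one_ne_zero
        exact ⟨(smul_eq_zero.mp hg).resolve_right h1ne, h₁, h₂⟩
      · exfalso
        have hr' : r = (-(g₁⁻¹ * g₀)) • (1 : Matrix (Fin 2) (Fin 2) L) := by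
          have : g₁ • r = -(g₀ • (1 : Matrix (Fin 2) (Fin 2) L)) := by
            rw [h₂, zero_smul, add_zero] at hg
            exact eq_neg_of_add_eq_zero_right hg
          calc r = g₁⁻¹ • (g₁ • r) := by rw [smul_smul, inv_mul_cancel₀ h₁, one_smul]
            _ = _ := by rw [this, smul_neg, smul_smul, neg_smul]
        exact hrs (by rw [hr', Matrix.smul_mul, Matrix.mul_smul, Matrix.one_mul, Matrix.mul_one])
    · exfalso
      have hs' : s = (-(g₂⁻¹ * g₀)) • (1 : Matrix (Fin 2) (Fin 2) L) + (-(g₂⁻¹ * g₁)) • r := by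
        have : g₂ • s = -(g₀ • (1 : Matrix (Fin 2) (Fin 2) L) + g₁ • r) :=
          eq_neg_of_add_eq_zero_right hg
        calc s = g₂⁻¹ • (g₂ • s) := by rw [smul_smul, inv_mul_cancel₀ h₂, one_smul]
          _ = _ := by rw [this, smul_neg, smul_add, smul_smul, smul_smul, neg_add, neg_smul, neg_smul]
      exact hrs (by
        rw [hs', mul_add, add_mul, Matrix.smul_mul, Matrix.mul_smul, Matrix.one_mul, Matrix.mul_one,
          Matrix.smul_mul, Matrix.mul_smul])
  -- every element of `A` is a combination of `1, r, s`
  have hdep : ∀ t ∈ A, ∃ α β γ : L, t = α • 1 + β • r + γ • s := by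
    intro t ht
    have hnot : ¬ LinearIndependent L ![(1 : Matrix (Fin 2) (Fin 2) L), r, s, t] := by
      intro hli
      have h4 := finrank_span_eq_card hli
      rw [Fintype.card_fin] at h4
      have hle : Submodule.span L (Set.range ![(1 : Matrix (Fin 2) (Fin 2) L), r, s, t]) ≤ A := by
        rw [Submodule.span_le]
        rintro _ ⟨i, rfl⟩
        fin_cases i
        · exact Submodule.subset_span R.one_mem
        · exact Submodule.subset_span hr
        · exact Submodule.subset_span hs
        · exact ht
      have := Submodule.finrank_mono hle
      omega
    rw [Fintype.not_linearIndependent_iff] at hnot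
    obtain ⟨g, hg, i, hi⟩ := hnot
    simp only [Fin.sum_univ_four, Matrix.cons_val_zero, Matrix.cons_val_one, Matrix.head_cons,
      Matrix.cons_val_two, Matrix.tail_cons, Matrix.cons_val_three] at hg
    by_cases h3 : g 3 = 0
    · exfalso
      rw [h3, zero_smul, add_zero] at hg
      obtain ⟨h0, h1, h2'⟩ := hrel _ _ _ hg
      fin_cases i
      exacts [hi h0, hi h1, hi h2', hi h3]
    · refine ⟨-(g 3)⁻¹ * g 0, -(g 3)⁻¹ * g 1, -(g 3)⁻¹ * g 2, ?_⟩
      have : g 3 • t = -(g 0 • (1 : Matrix (Fin 2) (Fin 2) L) + g 1 • r + g 2 • s) :=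
        eq_neg_of_add_eq_zero_right hg
      calc t = (g 3)⁻¹ • (g 3 • t) := by rw [smul_smul, inv_mul_cancel₀ h3, one_smul]
        _ = _ := by rw [this]; simp only [smul_neg, smul_add, smul_smul, neg_add, neg_smul, neg_mul]
  obtain ⟨α, β, γ, hαβγ⟩ := hdep (r * s) (Submodule.subset_span (R.mul_mem hr hs))
  obtain ⟨α', β', γ', hαβγ'⟩ := hdep (s * r) (Submodule.subset_span (R.mul_mem hs hr))
  set n : Matrix (Fin 2) (Fin 2) L := r * s - s * r with hn
  have hnR : n ∈ R := R.sub_mem (R.mul_mem hr hs) (R.mul_mem hs hr)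
  have hn0 : n ≠ 0 := sub_ne_zero.mpr hrs
  have hn' : n = (α - α') • 1 + (β - β') • r + (γ - γ') • s := by
    rw [hn, hαβγ, hαβγ']; module
  have htr0 : n.trace = 0 := by
    rw [hn, Matrix.trace_sub, Matrix.trace_mul_comm, sub_self]
  -- `n` is an `ad`-eigenvector of `r` and of `s`
  have hrn : r * n - n * r = (γ - γ') • n := by
    conv_lhs => rw [hn']
    rw [hn]
    simp only [mul_add, add_mul, Matrix.mul_smul, Matrix.smul_mul, mul_one, one_mul, smul_sub]
    noncomm_ring
  have hsn : s * n - n * s = (-(β - β')) • n := by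
    conv_lhs => rw [hn']
    rw [hn]
    simp only [mul_add, add_mul, Matrix.mul_smul, Matrix.smul_mul, mul_one, one_mul, smul_sub,
      neg_smul]
    noncomm_ring
  have htr2 : (n * n).trace = 0 := by
    by_cases hC : γ - γ' = 0
    · by_cases hB : β - β' = 0
      · exfalso
        rw [hB, hC, zero_smul, zero_smul, add_zero, add_zero] at hn'
        rw [hn', Matrix.trace_smul, Matrix.trace_one, Fintype.card_fin, smul_eq_mul] at htr0
        have hα : α - α' = 0 := by
          rcases mul_eq_zero.mp htr0 with h | h
          · exact h
          · exact absurd (by exact_mod_cast h) h2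
        exact hn0 (by rw [hn', hα, zero_smul])
      · exact trace_mul_self_eq_zero_of_lie_eq_smul (neg_ne_zero.mpr hB) hsn
    · exact trace_mul_self_eq_zero_of_lie_eq_smul hC hrn
  have hdet : n.det = 0 := by
    have h := trace_mul_self_fin_two n
    rw [htr2, htr0] at h
    have : (2 : L) * n.det = 0 := by linear_combination h
    exact (mul_eq_zero.mp this).resolve_left h2
  exact ((Matrix.isUnit_iff_isUnit_det n).mp (hR n hnR hn0)).ne_zero hdet

/-- **A subring of `M₂(L)` without non-zero singular elements which is not commutative spans
`M₂(L)` over `L`** (contrapositive of `subring_comm_of_span_ne_top`). [folklore] -/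
theorem span_subring_eq_top_of_mul_ne {L : Type*} [Field L] (h2 : (2 : L) ≠ 0)
    (R : Subring (Matrix (Fin 2) (Fin 2) L)) (hR : ∀ r ∈ R, r ≠ 0 → IsUnit r)
    {r s : Matrix (Fin 2) (Fin 2) L} (hr : r ∈ R) (hs : s ∈ R) (hrs : r * s ≠ s * r) :
    Submodule.span L (R : Set (Matrix (Fin 2) (Fin 2) L)) = ⊤ := by
  by_contra hne
  exact hrs (subring_comm_of_span_ne_top h2 R hR hne r hr s hs)

end Literature.AlgebraicGeometry.Motives

/-! ## The image of `End_K(E)` in `End(T_ℓ E)` and in `M₂(ℚ_ℓ)` -/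

namespace Literature.AlgebraicGeometry.Motives

open WeierstrassCurve

variable {K : Type u} [Field K] (W : WeierstrassCurve K) (ℓ : ℕ) [Fact ℓ.Prime]

/-- An element of `End_K(E)` with zero Tate-module map is zero (an isogeny has an injective
Tate-module map, the tree's `tateModule_map_injective`, and `T_ℓ E ≠ 0` for `ℓ ≠ char K`).
Silverman, *AEC*, III.§7 (`End(E) → End(T_ℓ E)` is injective). [cite: SilvermanAEC2009, III.7.4] -/
theorem eq_zero_of_tateEndRingHom_eq_zero [W.IsElliptic] (hℓ : (ℓ : K) ≠ 0) {a : W.endRing}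
    (ha : tateEndRingHom W ℓ a = 0) : a = 0 := by
  rcases eq_zero_or_exists_isogeny_of_mem_endRing W (mem_geomEndRing_iff_holds W) a.2 with
    h0 | ⟨χ, hχ⟩
  · exact Subtype.ext h0
  · exfalso
    haveI := nontrivial_tateModule W ℓ hℓ
    obtain ⟨x, hx⟩ := exists_ne (0 : W.tateModule ℓ)
    refine hx (tateModule_map_injective ℓ χ ?_)
    rw [map_zero]
    have h1 : Literature.NumberTheory.EllipticCurves.TateModule.map ℓ χ.toAddMonoidHom = tateEndRingHom W ℓ a := by
      rw [tateEndRingHom_apply]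
      congr 1
    rw [h1, ha, LinearMap.zero_apply]

/-- The `tateEndRingHom` of `End_K(E)` is injective for `ℓ ≠ char K`. Silverman, *AEC*, III.§7.
[cite: SilvermanAEC2009, III.7.4] -/
theorem tateEndRingHom_injective [W.IsElliptic] (hℓ : (ℓ : K) ≠ 0) :
    Function.Injective (tateEndRingHom W ℓ) :=
  injective_iff_map_eq_zero _ |>.mpr fun _ ha ↦ eq_zero_of_tateEndRingHom_eq_zero W ℓ hℓ ha

/-- The Tate-module map of a non-zero element of `End_K(E)` is injective on `T_ℓ E` (it is the
Tate-module map of an isogeny). Silverman, *AEC*, III.§7. [folklore] -/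
theorem injective_tateEndRingHom_of_ne_zero [W.IsElliptic] {a : W.endRing} (ha : a ≠ 0) :
    Function.Injective (tateEndRingHom W ℓ a) := by
  rcases eq_zero_or_exists_isogeny_of_mem_endRing W (mem_geomEndRing_iff_holds W) a.2 with
    h0 | ⟨χ, hχ⟩
  · exact absurd (Subtype.ext h0) ha
  · have h1 : tateEndRingHom W ℓ a = Literature.NumberTheory.EllipticCurves.TateModule.map ℓ χ.toAddMonoidHom := by
      rw [tateEndRingHom_apply]
      congr 1
      exact hχ.symm
    rw [h1]
    exact tateModule_map_injective ℓ χ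

/-- **Tate's theorem, `ℚ_ℓ`-form, for an elliptic curve with non-commutative `End_K(E)`.** Let
`E` be an elliptic curve over a field `K`, `ℓ` a prime with `ℓ ≠ 0` in `K`, and suppose two
elements `a, b ∈ End_K(E)` do not commute. Then for every `ℤ_ℓ`-linear endomorphism `g` of `T_ℓ E`
some `ℓ ^ n • g` lies in the `ℤ_ℓ`-span of the image of `End_K(E)`: identify `End(T_ℓ E)` with
`M₂(ℤ_ℓ) ⊆ M₂(ℚ_ℓ)` (`T_ℓ E ≅ ℤ_ℓ²`, *AEC* III.7.1); the image `R` of `End_K(E)` is a subring of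
`M₂(ℚ_ℓ)` whose non-zero elements are injective on `ℤ_ℓ²`, hence invertible in `M₂(ℚ_ℓ)`, and
which is not commutative (`End_K(E) → End(T_ℓ E)` is injective), so `ℚ_ℓ R = M₂(ℚ_ℓ)`
(`span_subring_eq_top_of_mul_ne`); clearing the denominators of `1 ⊗ g = Σ c_a T_ℓ(a)` gives
`d • g ∈ ℤ_ℓ · End_K(E)` with `d ≠ 0`, `d = ℓ ^ n ·` unit. This is the rank count of Tate,
Invent. Math. 2 (1966), §2 (end of proof of the Main Theorem: in the central case `F ⊗ ℚ_ℓ` is the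
full matrix algebra) for `g = 1`. [cite: Tate1966Endomorphisms, Main Theorem and §2] -/
theorem exists_pow_smul_mem_span_range_tateEndRingHom_of_mul_ne [W.IsElliptic] (hℓ : (ℓ : K) ≠ 0)
    {a b : W.endRing} (hab : a * b ≠ b * a) (g : Module.End ℤ_[ℓ] (W.tateModule ℓ)) :
    ∃ n : ℕ, (ℓ : ℤ_[ℓ]) ^ n • g ∈ Submodule.span ℤ_[ℓ] (Set.range (tateEndRingHom W ℓ)) := by
  set S := Submodule.span ℤ_[ℓ] (Set.range (tateEndRingHom W ℓ)) with hS
  -- it suffices to find `d ≠ 0` with `d • g ∈ S`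
  suffices key : ∃ d : ℤ_[ℓ], d ≠ 0 ∧ d • g ∈ S by
    obtain ⟨d, hd, hdg⟩ := key
    obtain ⟨n, u, rfl⟩ : ∃ (n : ℕ) (u : ℤ_[ℓ]ˣ), d = u * (ℓ : ℤ_[ℓ]) ^ n :=
      ⟨_, _, PadicInt.unitCoeff_spec hd⟩
    refine ⟨n, ?_⟩
    have hu : (ℓ : ℤ_[ℓ]) ^ n • g =
        ((u⁻¹ : ℤ_[ℓ]ˣ) : ℤ_[ℓ]) • (((u : ℤ_[ℓ]) * (ℓ : ℤ_[ℓ]) ^ n) • g) := by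
      rw [smul_smul, ← mul_assoc, Units.inv_mul, one_mul]
    rw [hu]
    exact S.smul_mem _ hdg
  -- `End(T_ℓ E) ≅ M₂(ℤ_ℓ) → M₂(ℚ_ℓ)`
  obtain ⟨e⟩ := nonempty_tateModule_linearEquiv W ℓ hℓ
  let ι₁ : Module.End ℤ_[ℓ] (W.tateModule ℓ) ≃ₐ[ℤ_[ℓ]] Matrix (Fin 2) (Fin 2) ℤ_[ℓ] :=
    (e.conjAlgEquiv ℤ_[ℓ]).trans LinearMap.toMatrixAlgEquiv'
  let ι₂ : Matrix (Fin 2) (Fin 2) ℤ_[ℓ] →ₐ[ℤ_[ℓ]] Matrix (Fin 2) (Fin 2) ℚ_[ℓ] :=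
    (Algebra.ofId ℤ_[ℓ] ℚ_[ℓ]).mapMatrix
  let ι : Module.End ℤ_[ℓ] (W.tateModule ℓ) →ₐ[ℤ_[ℓ]] Matrix (Fin 2) (Fin 2) ℚ_[ℓ] :=
    ι₂.comp ι₁.toAlgHom
  have hι₂ : Function.Injective ι₂ := fun M N h ↦
    Matrix.map_injective (IsFractionRing.injective ℤ_[ℓ] ℚ_[ℓ]) h
  have hι : Function.Injective ι := hι₂.comp ι₁.injective
  -- the image `R` of `End_K(E)` in `M₂(ℚ_ℓ)`
  set ρ : W.endRing →+* Matrix (Fin 2) (Fin 2) ℚ_[ℓ] := ι.toRingHom.comp (tateEndRingHom W ℓ)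
    with hρ
  have hρapp : ∀ a, ρ a = ι (tateEndRingHom W ℓ a) := fun a ↦ rfl
  set R : Subring (Matrix (Fin 2) (Fin 2) ℚ_[ℓ]) := ρ.range with hR
  -- non-zero elements of `R` are invertible
  have hRunit : ∀ r ∈ R, r ≠ 0 → IsUnit r := by
    rintro _ ⟨a, rfl⟩ hr0
    have ha0 : a ≠ 0 := by
      rintro rfl
      exact hr0 (map_zero ρ)
    -- `det ≠ 0` in `ℤ_ℓ`: an injective endomorphism of `ℤ_ℓ²` has non-zero determinant
    have hinj : Function.Injective (e.conjAlgEquiv ℤ_[ℓ] (tateEndRingHom W ℓ a)) := by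
      intro x y hxy
      simp only [LinearEquiv.conjAlgEquiv_apply, LinearMap.coe_comp, LinearEquiv.coe_coe,
        Function.comp_apply] at hxy
      exact e.symm.injective (injective_tateEndRingHom_of_ne_zero W ℓ ha0 (e.injective hxy))
    have hdet : (ι₁ (tateEndRingHom W ℓ a)).det ≠ 0 := by
      intro h0
      obtain ⟨w, hw, hPw⟩ := Matrix.exists_mulVec_eq_zero_iff.mpr h0
      refine hw (hinj ?_)
      rw [map_zero]
      have : ι₁ (tateEndRingHom W ℓ a) =
          LinearMap.toMatrix' (e.conjAlgEquiv ℤ_[ℓ] (tateEndRingHom W ℓ a)) := rfl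
      rw [this, LinearMap.toMatrix'_mulVec] at hPw
      exact hPw
    rw [Matrix.isUnit_iff_isUnit_det, isUnit_iff_ne_zero, hρapp]
    change (ι₂ (ι₁ (tateEndRingHom W ℓ a))).det ≠ 0
    have : (ι₂ (ι₁ (tateEndRingHom W ℓ a))).det =
        algebraMap ℤ_[ℓ] ℚ_[ℓ] (ι₁ (tateEndRingHom W ℓ a)).det := by
      change ((algebraMap ℤ_[ℓ] ℚ_[ℓ]).mapMatrix (ι₁ (tateEndRingHom W ℓ a))).det = _
      rw [← RingHom.map_det]
    rw [this]
    exact fun h ↦ hdet ((IsFractionRing.injective ℤ_[ℓ] ℚ_[ℓ]) (h.trans (map_zero _).symm))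
  -- `R` is not commutative
  have hρab : ρ a * ρ b ≠ ρ b * ρ a := by
    intro h
    rw [← map_mul, ← map_mul] at h
    exact hab ((tateEndRingHom_injective W ℓ hℓ) (hι h))
  -- hence `ℚ_ℓ R = M₂(ℚ_ℓ)`
  have h2 : (2 : ℚ_[ℓ]) ≠ 0 := two_ne_zero
  have htop := span_subring_eq_top_of_mul_ne h2 R hRunit ⟨a, rfl⟩ ⟨b, rfl⟩ hρab
  -- write `ι g` in the `ℚ_ℓ`-span and clear denominators
  have hmem : ι g ∈ Submodule.span ℚ_[ℓ] (Set.range ρ) := by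
    have : (R : Set (Matrix (Fin 2) (Fin 2) ℚ_[ℓ])) = Set.range ρ := by
      rw [hR]; exact RingHom.coe_range ρ
    rw [← this, htop]
    exact Submodule.mem_top
  obtain ⟨c, hc⟩ := Finsupp.mem_span_range_iff_exists_finsupp.mp hmem
  obtain ⟨⟨d, hd0⟩, hint⟩ :=
    IsLocalization.exist_integer_multiples (nonZeroDivisors ℤ_[ℓ]) c.support c
  have hint' : ∀ a ∈ c.support, ∃ z : ℤ_[ℓ], algebraMap ℤ_[ℓ] ℚ_[ℓ] z = d • c a :=
    fun a ha ↦ hint a ha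
  choose! z hz using hint'
  refine ⟨d, nonZeroDivisors.ne_zero hd0, ?_⟩
  have key : d • g = ∑ a ∈ c.support, z a • tateEndRingHom W ℓ a := by
    apply hι
    rw [map_smul, map_sum, ← hc, Finsupp.sum, Finset.smul_sum]
    refine Finset.sum_congr rfl fun a ha ↦ ?_
    rw [map_smul, ← hρapp, ← smul_assoc, ← algebraMap_smul ℚ_[ℓ] (z a), hz a ha]
  rw [key]
  exact Submodule.sum_mem _ fun a _ ↦ Submodule.smul_mem _ _ (Submodule.subset_span ⟨a, rfl⟩)

/-- **Tate's theorem, `End` form, for an elliptic curve over a finite field with non-commutative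
`End_k(E)`** (proved): every `Γ_k`-equivariant… indeed every `ℤ_ℓ`-linear endomorphism of `T_ℓ E`
lies in `ℤ_ℓ · End_k(E)`, by `exists_pow_smul_mem_span_range_tateEndRingHom_of_mul_ne` and the
saturation of `ℤ_ℓ · End_k(E)` in `End(T_ℓ E)` (Tate's Lemma 1; the tree's
`mem_span_range_tateEndRingHom_of_smul_mem` with *AEC* III.§4 and Cor. III.4.11 discharged by
`mem_geomEndRing_iff_holds`, `Isogeny.exists_eq_comp_nsmul_of_geomTorsion_le_ker_holds`). (For
these curves — the supersingular ones with all endomorphisms defined over `k` — `Γ_k` acts on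
`T_ℓ E` through scalars, so every endomorphism is equivariant.) Tate, Invent. Math. 2 (1966),
Main Theorem; Waterhouse, Ann. Sci. ÉNS 2 (1969), Thm. 4.1. [cite: Tate1966Endomorphisms, Main Theorem] -/
theorem mem_span_range_tateEndRingHom_of_mul_ne [W.IsElliptic] (hℓ : (ℓ : K) ≠ 0)
    {a b : W.endRing} (hab : a * b ≠ b * a) (g : Module.End ℤ_[ℓ] (W.tateModule ℓ)) :
    g ∈ Submodule.span ℤ_[ℓ] (Set.range (tateEndRingHom W ℓ)) := by
  obtain ⟨n, hn⟩ := exists_pow_smul_mem_span_range_tateEndRingHom_of_mul_ne W ℓ hℓ hab g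
  have hℓ0 : (ℓ : ℤ_[ℓ]) ^ n ≠ 0 := pow_ne_zero _ (Nat.cast_ne_zero.mpr (Fact.out : ℓ.Prime).ne_zero)
  exact mem_of_padicInt_smul_mem
    (fun g' hg' ↦ mem_span_range_tateEndRingHom_of_smul_mem W ℓ
      (fun _ hψ ↦ eq_zero_or_exists_isogeny_of_mem_endRing W (mem_geomEndRing_iff_holds W) hψ)
      (fun χ hχ ↦ Isogeny.exists_eq_comp_nsmul_of_geomTorsion_le_ker_holds W W hℓ χ hχ) hg')
    hℓ0 hn

end Literature.AlgebraicGeometry.Motives
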